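import Literature.AnabelianGeometry.SemiGraphs.ArithMaximalCompact
import HarnessLib

/-!
# [SemiAnbd] §5 p.65: every edge-like subgroup lies in a verticial subgroup (`Π^temp_{𝔊,b} ⊆ Π^temp_{𝔊,v}`)

Mochizuki, *Semi-graphs of anabelioids*, Publ. RIMS **42** (2006) 221–322, §5, p. 65
[cite: MochizukiSemiAnbd2006, Def 5.3 (iii) p.65]: "if `b` is a branch of an edge `e` of `𝔾` that abuts to
`v`, then we obtain a decomposition group `Π^temp_{𝔊,b} ⊆ Π^temp_{𝔊,v} ⊆ Π^temp_𝔊` [well-defined up to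
conjugation in `Π^temp_𝔊`]". Over abc-iut-L3-t3's data of p. 65 (`DecompositionData`, field
`brGp_le_vertGp`; `ArithMaximalCompact.lean`) this gives, as soon as EVERY branch abuts to a vertex (the
case of Theorem 5.4: "arithmetic GRAPHS of anabelioids", every edge of verticial cardinality 2): every
edge-like subgroup (a conjugate of some `Π^temp_{𝔊,b}`, `IsEdgeLike`) lies in a verticial subgroup (the
same conjugate of `Π^temp_{𝔊,v}`, `IsVerticial`). PROOF-ONLY (abc-iut cell, sub-DAG Thm54; the binder
`hEdgeVert` of abc-iut-w4-d029's `arith_conj1_of_hstar`, row T54-3b). Nothing here bears on [IUTchIII]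
Cor. 3.12.
-/

namespace Literature.AnabelianGeometry.SemiGraphs

universe u w w'

variable {Gtp : Type u} [Group Gtp] {V : Type w} {B : Type w'}

/-- **`Π^temp_{𝔊,b} ⊆ Π^temp_{𝔊,v}` for all conjugates** ([SemiAnbd] p.65): if every branch abuts to a vertex,
every edge-like subgroup of the data `D` lies in a verticial subgroup — the binder `hEdgeVert` of
`arith_conj1_of_hstar`. [cite: MochizukiSemiAnbd2006, Def 5.3 (iii) p.65] -/
theorem DecompositionData.exists_isVerticial_ge_of_isEdgeLike (D : DecompositionData Gtp V B)
    (habuts : ∀ b : B, ∃ v : V, D.abut b = some v) (L : Subgroup Gtp) (hL : IsEdgeLike D L) :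
    ∃ W : Subgroup Gtp, IsVerticial D W ∧ L ≤ W := by
  obtain ⟨b, g, rfl⟩ := hL
  obtain ⟨v, hv⟩ := habuts b
  exact ⟨conjSubgroup g (D.vertGp v), ⟨v, g, rfl⟩, Subgroup.map_mono (D.brGp_le_vertGp b v hv)⟩

end Literature.AnabelianGeometry.SemiGraphs
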